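import Literature.NumberTheory.Automorphic.ArchInnerFormChartOrbitalSmooth        -- ★ p850500∕p850509 (this seat): `contDiffOn_chartOrbG_of_uniformlyProper`, `contDiff_coe_gprimeTorus`, `contDiffOn_archRG_regG`
import Literature.NumberTheory.Rogawski1990.ArchInnerFormSplitPlaceProper          -- ★ p850470 (J-DESC) SPLIT-DOCK F0P3a-p08 (g22): `uniformlyProper_gprimeBlock_split_of_ne_zero`, `symm_archPiEquivCM_mem_centralizer_gprimeTorus_iff`; brings ★ D1c∕D4a
import Literature.NumberTheory.Automorphic.UnitaryFormGroupTestFunctionExtension   -- ★ `isClosedEmbedding_coe_unitaryGroupOfForm` (`U(H)(ℂ) ↪ M_n(ℂ)` closed embedding)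
import Literature.NumberTheory.Automorphic.UnitaryFormGroupSemiregularProper       -- ★ D1 `continuousSMul_unitaryGroupOfForm_vec` (the action on `ℂⁿ` is continuous)
import HarnessLib

/-!
# The ordinary orbital family of `G′_∞` is `C^∞` ACROSS THE COMPACT WALLS: `orbFamGExt ν′ a′ S′` on `InRegG s S′` off the real walls
# («(I₂-cptwall-G′)»; Harish-Chandra ∕ Varadarajan 1977 I §1.12; Rogawski 1990 §8.2–8.3, §4.12; Shelstad 1979 §4; Bouaziz 1994 §3.2, §6.2)

Topic `NumberTheory/Automorphic`; namespaces `Literature.MeasureTheory.Group` (§1, generic), `Literature.NumberTheory.Automorphic.UnitaryGroup` (§2–§4a),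
`Literature.NumberTheory.Automorphic.ArchCartan` (§4b) and `Literature.NumberTheory.Rogawski1990` (§4c).  THEOREMS ONLY (no `def`, no instance, no notation, no axiom, no named
fact, no `sorry`).  Cell `pub/hodgecm-mathlib`, crux H413 (`stmt-HodgeConjecture-24833`), line LH3 (closer stub `stub_N9`, direct road), LETTER L1 `HcOrbitalFamiliesStatement`,
clause (I₂) `ContDiffOn ℝ ∞ (F S′) (InRegG s S′)` of ★ `ArchHcSmoothOneSided` for the GENUINE family — paid HYPOTHESIS-FREE on `InRegG` OFF THE REAL WALLS (seat F0P3a-p05 (g20);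
LH3-plan (g3) 2026-09-02T08:17:49Z «letter-L1 pay-down»).  Sequel of ★ `ArchInnerFormChartOrbitalSmooth` (p850500∕p850509: the regular set `RegG S′`); count-neutral.

THE MATHEMATICS.  `InRegG s S′ ⊋ RegG S′` also contains, at each compact-chart place `w ∉ S′`, the COMPACT walls — the collision of the two SAME-sign slots `0, 1`
(`e^{i c_w 0} = e^{i c_w 1}`; only the odd slot `2` has to stay simple) — and, at a DEFINITE place, every point.  At such a point the orbital integral is NOT proper modulo the chart
torus `T_{S′}` in the naive sense, but it is proper modulo the stabiliser of the odd line `e_{odd}`, uniformly ACROSS the wall (★ D1c `uniformlyProper_gprimeBlock_cpt_of_ne`), and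
THAT STABILISER IS COMPACT — it is the unitary group of the orthogonal plane `e_{odd}^⊥`, which carries the two coefficients of the majority sign, a DEFINITE plane (§2
`isCompact_stabilizer_single_of_sameSign`: `g e_ℓ = e_ℓ`, `gᴴ D g = D` ⇒ the `ℓ`-th row and column are `e_ℓ` and `Σ_{m ≠ ℓ} a_m |g_{mi}|² = a_i` with all `a` of one sign bounds the
entries; closed + bounded under ★ `isClosedEmbedding_coe_unitaryGroupOfForm`).  Uniform properness modulo a COMPACT subgroup upgrades to uniform properness modulo ANY subgroup
(§1, generic: lift the compact set of cosets, ★ `exists_isCompact_image_mk_superset`), so the atlas is uniformly proper modulo `T_{S′}` on the whole open set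
`V = {c ∣ (∀ w ∈ S′, x_w ≠ 0) ∧ c ∈ InRegG (slotSign α) S′}` (§3: split places of `S′` on `{x_w ≠ 0}` by ★ SPLIT-DOCK `uniformlyProper_gprimeBlock_split_of_ne_zero`, definite places
everywhere by ★ `uniformlyProper_archLocal_of_definite`, places assembly ★ `uniformlyProper_arch_of_places` modulo `Z(gprimeTorus c₁) = T_{S′}` at a regular `c₁`, ★ `dense_regG`,
★ `chartTorusG_eq_centralizer`, ★ `symm_archPiEquivCM_mem_centralizer_gprimeTorus_iff`) — and the Hörmander head ★ `contDiffOn_chartOrbG_of_uniformlyProper` applies VERBATIM on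
`V`: NO descent to the centraliser, NO cut-off, NO block decomposition (§4: **`contDiffOn_chartOrbG_inRegG`**; `archRG` is smooth off the real walls —
`contDiffOn_archRG_of_forall_ne`; **`contDiffOn_orbFamG_inRegG`**).  Finally the wall-extended family ★ `orbFamGExt = hcExtendG (orbFamG)` AGREES with `orbFamG` on `V` (at a wall
point of `V` the `RegG`-limit exists and is the value, by continuity on the open `V` and ★ `mem_closure_regG`: `orbFamGExt_eqOn_orbFamG_inRegG`), whence
**`contDiffOn_orbFamGExt_inRegG_of_forall_ne : ContDiffOn ℝ ∞ (orbFamGExt L α ν′ a′ S′) {c | (∀ w ∈ S′, c w 0 ≠ 0) ∧ c ∈ InRegG (slotSign L α) S′}`** for every `a′ ∈ C_c^∞(G′_∞)` and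
every label `S′` (plus the `C⁰` twins for `a′ ∈ C_c(G′_∞)`).
HONEST LABEL: what remains of clause (I₂) for the genuine family is EXACTLY the real walls `x_w = 0` of the split places `w ∈ S′` — Harish-Chandra's smooth extension of
`|D|^{1∕2} Φ_f` across the split wall (order 0 = ★ (A0) `ArchRankOneSplitOrbitContinuity*`; all orders open here) — together with the bounded-jets clause and the one-sided
limits ∕ jump relations (I₃); letter L1 stays a letter.  HC_CM is proved only modulo the printed citations (2 remaining named inputs: hLiu418 = `stmt-HodgeConjecture-24832`,
h413 = `stmt-HodgeConjecture-24833`) until rung 0 closes; this file moves no row of the books.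

## References
* [Varadarajan1977] V. S. Varadarajan, *Harmonic Analysis on Real Reductive Groups*, LNM 576 (1977), Part I §1.12 (`'F_f` smooth on `T_{in-reg}`, across the compact walls).
* [Rogawski1990] J. D. Rogawski, *Automorphic Representations of Unitary Groups in Three Variables*, Ann. of Math. Stud. 123 (1990), §3.6 pp. 31–32 (elliptic tori; the compact
  Cartans), §4.3 p. 43, §4.12 Lemma 4.12.1 p. 66 (compactness lemma), §8.2 pp. 118–123, §8.3 pp. 122–124.
* [Shelstad1979] D. Shelstad, *Characters and inner forms of a quasi-split group over ℝ*, Compositio Math. 39 (1979), §4 pp. 22–24 (`Ψ^T_f` smooth across the compact walls).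
* [Bouaziz1994IntegralesOrbitales] A. Bouaziz, *Intégrales orbitales sur les groupes de Lie réductifs*, Ann. Sci. ÉNS 27 (1994), §3.2 p. 580 ((I₂)), §6.2 p. 591 (`T_{in-reg}`).
* [HarishChandra1970] Harish-Chandra (notes by G. van Dijk), *Harmonic Analysis on Reductive p-adic Groups*, LNM 162 (1970), Part I §3 Lemma 22.
* [DeitmarEchterhoff2014] A. Deitmar, S. Echterhoff, *Principles of Harmonic Analysis*, 2nd ed. (2014), Remark 1.5.2, Lemma 9.3.3.
* [PlatonovRapinchuk1994] V. Platonov, A. Rapinchuk, *Algebraic Groups and Number Theory* (1994), §3.2 Thm. 3.1 (anisotropic ⟺ compact at `∞`).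
* [Knapp1986] A. W. Knapp, *Representation Theory of Semisimple Groups* (1986), Ch. V §3.
-/

set_option autoImplicit false

noncomputable section

open MeasureTheory Matrix NumberField NumberField.InfinitePlace NumberField.mixedEmbedding Set Function Topology Complex
open Literature.MeasureTheory.Group Literature.NumberTheory.Rogawski1990 Literature.NumberTheory.Automorphic.ArchCartan
open Literature.NumberTheory.Automorphic.UnitaryGroup
open scoped MatrixGroups ContDiff Classical Pointwise
open scoped Matrix.Norms.Operator

/-! ## §1 Generic: (HYP) modulo a COMPACT subgroup upgrades to (HYP) modulo ANY subgroup -/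

namespace Literature.MeasureTheory.Group

section CompactUpgrade

variable {G : Type*} [Group G] [TopologicalSpace G] [IsTopologicalGroup G] [LocallyCompactSpace G]
  {X : Type*} [TopologicalSpace X]

/-- **(HYP) MODULO A COMPACT SUBGROUP ⇒ (HYP) MODULO EVERY SUBGROUP.**  If the chart `c : X → G` is uniformly proper on `S` modulo a COMPACT subgroup `M`, then the
conjugating sets `{y ∣ y · c x · y⁻¹ ∈ C, x ∈ K}` are themselves relatively compact in `G` (lift the compact `𝒦 ⊆ G ⧸ M` to a compact `A ⊆ G`, ★ `exists_isCompact_image_mk_superset`;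
then the set lies in `A · M`, compact), hence compact modulo any `M′`. [cite: DeitmarEchterhoff2014, Remark 1.5.2; Lemma 9.3.3] [cite: HarishChandra1970, Part I §3 Lemma 22] -/
theorem uniformlyProper_of_isCompact_subgroup (M M' : Subgroup G) (hM : IsCompact (M : Set G)) (c : X → G) {S : Set X}
    (h : ∀ K ⊆ S, IsCompact K → ∀ C : Set G, IsCompact C →
      ∃ 𝒦 : Set (G ⧸ M), IsCompact 𝒦 ∧ ∀ x ∈ K, ∀ y : G, y * c x * y⁻¹ ∈ C → (QuotientGroup.mk y : G ⧸ M) ∈ 𝒦) :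
    ∀ K ⊆ S, IsCompact K → ∀ C : Set G, IsCompact C →
      ∃ 𝒦' : Set (G ⧸ M'), IsCompact 𝒦' ∧ ∀ x ∈ K, ∀ y : G, y * c x * y⁻¹ ∈ C → (QuotientGroup.mk y : G ⧸ M') ∈ 𝒦' := by
  intro K hK hKc C hC
  obtain ⟨𝒦, h𝒦, hmem⟩ := h K hK hKc C hC
  obtain ⟨A, hA, hsub⟩ := exists_isCompact_image_mk_superset M h𝒦
  refine ⟨QuotientGroup.mk '' (A * (M : Set G)), (hA.mul hM).image continuous_quotient_mk', fun x hx y hy => ?_⟩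
  obtain ⟨a, ha, hay⟩ := hsub (hmem x hx y hy)
  rw [QuotientGroup.eq] at hay
  exact ⟨y, ⟨a, ha, a⁻¹ * y, hay, by group⟩, rfl⟩

end CompactUpgrade

end Literature.MeasureTheory.Group

/-! ## §2 At an indefinite place, the stabiliser of the ODD line is COMPACT (its orthogonal plane is definite) -/

namespace Literature.NumberTheory.Automorphic.UnitaryGroup

section Stabilizer

variable (L : Type) [Field L] (α : Fin 3 → L) (w : {w : InfinitePlace L // IsComplex w})

/-- **COMPACT STABILISER OF A LINE WITH DEFINITE ORTHOGONAL PLANE.**  In `G′_w = U(σ_w diag α)(ℂ)` (real diagonal form `D = diag(a)`, `a = formRe`), if the two lines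
`m ≠ ℓ₀` carry coefficients of the SAME sign (`a_m a_{m′} > 0`), the stabiliser of `e_{ℓ₀}` is COMPACT: for `g e_{ℓ₀} = e_{ℓ₀}`, `gᴴ D g = D` the `ℓ₀`-th column of `g` is `e_{ℓ₀}`, the
`ℓ₀`-th row vanishes off the diagonal (`(gᴴDg)_{ℓ₀ i} = a_{ℓ₀} g_{ℓ₀ i}`), and for `i ≠ ℓ₀` the identity `Σ_{m ≠ ℓ₀} a_m |g_{mi}|² = a_i` with all `a` of one sign bounds every entry;
closed + bounded under the closed embedding `G′_w ↪ M₃(ℂ)` (★ `isClosedEmbedding_coe_unitaryGroupOfForm`) ⇒ compact.  (`Stab(e_{ℓ₀}) ≅ U(e_{ℓ₀}^⊥)`, a DEFINITE unitary group —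
the compact-wall situation; at a noncompact wall the plane is hyperbolic and the stabiliser is not compact.) [cite: Rogawski1990, §3.6 pp. 31–32; §8.2 pp. 122–123]
[cite: PlatonovRapinchuk1994, §3.2 Thm. 3.1] [cite: Knapp1986, Ch. V §3] -/
theorem isCompact_stabilizer_single_of_sameSign (hα : ∀ i, α i ≠ 0) (hreal : ∀ i, (w.1.embedding (α i)).im = 0) (ℓ₀ : Fin 3)
    (hsame : ∀ m m', m ≠ ℓ₀ → m' ≠ ℓ₀ → 0 < formRe L α w m * formRe L α w m') :
    IsCompact ((MulAction.stabilizer ↥(archLocal L 3 (Matrix.diagonal α) w) (Pi.single ℓ₀ (1 : ℂ) : Fin 3 → ℂ) :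
      Subgroup ↥(archLocal L 3 (Matrix.diagonal α) w)) : Set ↥(archLocal L 3 (Matrix.diagonal α) w)) := by
  -- notation: the real diagonal form
  set a : Fin 3 → ℝ := formRe L α w with hadef
  have ha0 : ∀ i, a i ≠ 0 := fun i => formRe_ne_zero hα hreal i
  have hD : (Matrix.diagonal α).map w.1.embedding = Matrix.diagonal fun i => ((a i : ℝ) : ℂ) := diagonal_map_embedding_eq_of_real hreal
  -- the closed embedding into `M₃(ℂ)`
  have hdet : ((Matrix.diagonal α).map w.1.embedding).det ≠ 0 := by
    rw [hD, Matrix.det_diagonal]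
    exact Finset.prod_ne_zero_iff.2 fun i _ => by exact_mod_cast ha0 i
  have hemb : IsClosedEmbedding (fun g : ↥(archLocal L 3 (Matrix.diagonal α) w) => ((g : GL (Fin 3) ℂ) : Matrix (Fin 3) (Fin 3) ℂ)) :=
    isClosedEmbedding_coe_unitaryGroupOfForm _ hdet
  -- a uniform entry bound `ρ`
  obtain ⟨ρ, hρ1, hρ⟩ : ∃ ρ : ℝ, 1 ≤ ρ ∧ ∀ m i, m ≠ ℓ₀ → i ≠ ℓ₀ → |a i| / |a m| ≤ ρ ^ 2 := by
    refine ⟨1 + ∑ m, ∑ i, |a i| / |a m|, ?_, fun m i _ _ => ?_⟩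
    · have : 0 ≤ ∑ m, ∑ i, |a i| / |a m| := Finset.sum_nonneg fun m _ => Finset.sum_nonneg fun i _ => by positivity
      linarith
    · have h1 : |a i| / |a m| ≤ ∑ i', |a i'| / |a m| :=
        Finset.single_le_sum (f := fun i' => |a i'| / |a m|) (fun i' _ => by positivity) (Finset.mem_univ i)
      have h2 : ∑ i', |a i'| / |a m| ≤ ∑ m', ∑ i', |a i'| / |a m'| :=
        Finset.single_le_sum (f := fun m' => ∑ i', |a i'| / |a m'|) (fun m' _ => Finset.sum_nonneg fun i' _ => by positivity) (Finset.mem_univ m)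
      have h3 : (0 : ℝ) ≤ ∑ m', ∑ i', |a i'| / |a m'| := Finset.sum_nonneg fun m' _ => Finset.sum_nonneg fun i' _ => by positivity
      nlinarith
  -- the entry bounds on the stabiliser
  have hbound : ∀ g : ↥(archLocal L 3 (Matrix.diagonal α) w),
      g ∈ MulAction.stabilizer ↥(archLocal L 3 (Matrix.diagonal α) w) (Pi.single ℓ₀ (1 : ℂ) : Fin 3 → ℂ) →
        ∀ m i, ‖((g : GL (Fin 3) ℂ) : Matrix (Fin 3) (Fin 3) ℂ) m i‖ ≤ ρ := by
    intro g hg m i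
    set X : Matrix (Fin 3) (Fin 3) ℂ := ((g : GL (Fin 3) ℂ) : Matrix (Fin 3) (Fin 3) ℂ) with hXdef
    -- column `ℓ₀` of `X` is `e_{ℓ₀}`
    have hcol : ∀ k, X k ℓ₀ = if k = ℓ₀ then 1 else 0 := by
      intro k
      have h1 : X *ᵥ (Pi.single ℓ₀ (1 : ℂ) : Fin 3 → ℂ) = Pi.single ℓ₀ (1 : ℂ) := MulAction.mem_stabilizer_iff.1 hg
      have h2 := congrFun h1 k
      rw [Matrix.mulVec_single_one, Matrix.col_apply] at h2
      rw [h2, Pi.single_apply]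
    -- unitarity `Xᴴ D X = D` entrywise
    have hU : Xᴴ * (Matrix.diagonal fun i => ((a i : ℝ) : ℂ)) * X = Matrix.diagonal fun i => ((a i : ℝ) : ℂ) := by
      have h := (mem_archLocal_iff_conjTranspose L 3 (Matrix.diagonal α) w (g : GL (Fin 3) ℂ)).1 g.2
      rwa [hD] at h
    have hentry : ∀ i j, ∑ k, star (X k i) * (((a k : ℝ) : ℂ) * X k j) = if i = j then ((a i : ℝ) : ℂ) else 0 := by
      intro i j
      have h := congrFun (congrFun hU i) j
      rw [Matrix.mul_assoc, Matrix.mul_apply, Matrix.diagonal_apply] at h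
      simpa only [Matrix.conjTranspose_apply, Matrix.diagonal_mul] using h
    -- row `ℓ₀` vanishes off the diagonal
    have hrow : ∀ j, j ≠ ℓ₀ → X ℓ₀ j = 0 := by
      intro j hj
      have h := hentry ℓ₀ j
      rw [if_neg (Ne.symm hj), Finset.sum_eq_single ℓ₀ (fun k _ hk => by rw [hcol k, if_neg hk, star_zero, zero_mul])
        (fun h => (h (Finset.mem_univ _)).elim), hcol ℓ₀, if_pos rfl, star_one, one_mul] at h
      have ha : (((a ℓ₀ : ℝ) : ℂ)) ≠ 0 := by exact_mod_cast ha0 ℓ₀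
      exact (mul_eq_zero.1 h).resolve_left ha
    -- the diagonal identity for `i ≠ ℓ₀`: `Σ_{k ≠ ℓ₀} a_k ‖X k i‖² = a_i` (real form)
    have hdiag : ∀ i, i ≠ ℓ₀ → ∑ k ∈ Finset.univ.erase ℓ₀, a k * ‖X k i‖ ^ 2 = a i := by
      intro i hi
      have h := hentry i i
      rw [if_pos rfl, ← Finset.add_sum_erase _ _ (Finset.mem_univ ℓ₀), hrow i hi] at h
      simp only [star_zero, mul_zero, zero_add] at h
      have h' : ∀ k, star (X k i) * (((a k : ℝ) : ℂ) * X k i) = (((a k * ‖X k i‖ ^ 2 : ℝ)) : ℂ) := by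
        intro k
        rw [mul_left_comm, Complex.star_def, Complex.conj_mul', Complex.ofReal_mul, Complex.ofReal_pow]
      simp only [h'] at h
      rw [← Complex.ofReal_sum] at h
      exact_mod_cast h
    -- the bound
    by_cases hi : i = ℓ₀
    · subst hi
      rw [hcol m]
      split_ifs <;> simp <;> linarith
    by_cases hm : m = ℓ₀
    · subst hm
      rw [hrow i hi, norm_zero]; linarith
    -- `|a m| ‖X m i‖² ≤ |a i|`
    have hpos : 0 < a i * a m := hsame i m hi hm
    have hsum := hdiag i hi
    have hle : |a m| * ‖X m i‖ ^ 2 ≤ |a i| := by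
      -- all terms `a k ‖X k i‖²`, `k ≠ ℓ₀`, have the sign of `a i`
      rcases lt_or_gt_of_ne (ha0 i) with hai | hai
      · -- `a i < 0`: every `a k < 0` for `k ≠ ℓ₀`
        have hkall : ∀ k ∈ Finset.univ.erase ℓ₀, a k * ‖X k i‖ ^ 2 ≤ 0 := by
          intro k hk
          have hk' : k ≠ ℓ₀ := (Finset.mem_erase.1 hk).1
          have : a k < 0 := by
            have := hsame i k hi hk'
            nlinarith
          nlinarith [sq_nonneg ‖X k i‖]
        have h1 : a m * ‖X m i‖ ^ 2 ≥ ∑ k ∈ Finset.univ.erase ℓ₀, a k * ‖X k i‖ ^ 2 := by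
          have := Finset.single_le_sum (f := fun k => -(a k * ‖X k i‖ ^ 2)) (s := Finset.univ.erase ℓ₀)
            (fun k hk => by have := hkall k hk; linarith) (Finset.mem_erase.2 ⟨hm, Finset.mem_univ m⟩)
          simp only [Finset.sum_neg_distrib] at this
          linarith
        rw [hsum] at h1
        have ham : a m < 0 := by nlinarith
        rw [abs_of_neg ham, abs_of_neg hai]
        linarith
      · have hkall : ∀ k ∈ Finset.univ.erase ℓ₀, 0 ≤ a k * ‖X k i‖ ^ 2 := by
          intro k hk
          have hk' : k ≠ ℓ₀ := (Finset.mem_erase.1 hk).1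
          have : 0 < a k := by
            have := hsame i k hi hk'
            nlinarith
          positivity
        have h1 : a m * ‖X m i‖ ^ 2 ≤ ∑ k ∈ Finset.univ.erase ℓ₀, a k * ‖X k i‖ ^ 2 :=
          Finset.single_le_sum (f := fun k => a k * ‖X k i‖ ^ 2) hkall (Finset.mem_erase.2 ⟨hm, Finset.mem_univ m⟩)
        rw [hsum] at h1
        have ham : 0 < a m := by nlinarith
        rw [abs_of_pos ham, abs_of_pos hai]
        exact h1
    have hsq : ‖X m i‖ ^ 2 ≤ ρ ^ 2 := by
      have h1 : ‖X m i‖ ^ 2 ≤ |a i| / |a m| := by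
        rw [le_div_iff₀ (abs_pos.2 (ha0 m))]
        linarith
      exact h1.trans (hρ m i hm hi)
    have hρ0 : 0 ≤ ρ := by linarith
    nlinarith [norm_nonneg (X m i)]
  -- closed + bounded under a closed embedding ⇒ compact
  haveI : ContinuousSMul ↥(archLocal L 3 (Matrix.diagonal α) w) (Fin 3 → ℂ) := continuousSMul_unitaryGroupOfForm_vec
  have hclosed : IsClosed ((MulAction.stabilizer ↥(archLocal L 3 (Matrix.diagonal α) w) (Pi.single ℓ₀ (1 : ℂ) : Fin 3 → ℂ) :
      Subgroup ↥(archLocal L 3 (Matrix.diagonal α) w)) : Set ↥(archLocal L 3 (Matrix.diagonal α) w)) := by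
    have h : ((MulAction.stabilizer ↥(archLocal L 3 (Matrix.diagonal α) w) (Pi.single ℓ₀ (1 : ℂ) : Fin 3 → ℂ) : Subgroup _) : Set ↥(archLocal L 3 (Matrix.diagonal α) w)) =
        (fun g : ↥(archLocal L 3 (Matrix.diagonal α) w) => g • (Pi.single ℓ₀ (1 : ℂ) : Fin 3 → ℂ)) ⁻¹' {Pi.single ℓ₀ (1 : ℂ)} := by
      ext g; exact MulAction.mem_stabilizer_iff
    rw [h]
    exact isClosed_singleton.preimage (continuous_id.smul continuous_const)
  set box : Set (Matrix (Fin 3) (Fin 3) ℂ) := {M | ∀ m i, M m i ∈ Metric.closedBall (0 : ℂ) ρ} with hboxdef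
  have hbox : IsCompact box := by
    have hb : box = Set.univ.pi fun _ : Fin 3 => Set.univ.pi fun _ : Fin 3 => Metric.closedBall (0 : ℂ) ρ :=
      Set.ext fun M => ⟨fun h i _ j _ => h i j, fun h i j => h i (Set.mem_univ _) j (Set.mem_univ _)⟩
    rw [hb]
    exact isCompact_univ_pi fun _ => isCompact_univ_pi fun _ => isCompact_closedBall _ _
  refine (hemb.isCompact_preimage hbox).of_isClosed_subset hclosed fun g hg m i => ?_
  rw [Metric.mem_closedBall, dist_zero_right]
  exact hbound g hg m i

end Stabilizer

end Literature.NumberTheory.Automorphic.UnitaryGroup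

/-! ## §3 (HYP) modulo `T_{S′}` on the OFF-REAL-WALL part of `InRegG`: per place, then the places assembly -/

namespace Literature.NumberTheory.Automorphic.UnitaryGroup

section Places

variable (L : Type) [Field L] [NumberField L] [IsCMField L] (α : Fin 3 → L) (S' : Finset {w : InfinitePlace L // IsComplex w})

omit [NumberField L] [IsCMField L] in
open scoped ComplexOrder in
/-- **PER-PLACE (HYP) ON THE `w`-FACTOR OF `InRegG ∩ {x ≠ 0}`**, modulo `Z(gprimeBlock α w S′ c₁)` for a REGULAR reference point `c₁`: at a split place of `S′` on `{x_w ≠ 0}`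
(★ SPLIT-DOCK `uniformlyProper_gprimeBlock_split_of_ne_zero`); at a DEFINITE compact-chart place everywhere (★ `uniformlyProper_archLocal_of_definite`); at an INDEFINITE
compact-chart place on `{odd slot 2 simple}` — ★ D1c `uniformlyProper_gprimeBlock_cpt_of_ne` modulo the stabiliser of the odd line, which is COMPACT (§2), upgraded by §1.
[cite: Rogawski1990, §4.12 Lemma 4.12.1 p. 66; §8.2 pp. 122–123; §4.3 p. 43] [cite: HarishChandra1970, Part I §3 Lemma 22] [cite: PlatonovRapinchuk1994, §3.2 Thm. 3.1] -/
theorem uniformlyProper_gprimeBlock_of_inRegG_place (hα : ∀ i, α i ≠ 0) (hreal : ∀ (w : {w : InfinitePlace L // IsComplex w}) (i : Fin 3), (w.1.embedding (α i)).im = 0)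
    (hS' : ∀ w, w ∈ S' → w ∈ splitChartPlaces L α) {c₁ : {w : InfinitePlace L // IsComplex w} → Fin 3 → ℝ} (hc₁ : c₁ ∈ RegG S')
    (w : {w : InfinitePlace L // IsComplex w}) :
    ∀ K ⊆ {cw : Fin 3 → ℝ | (w ∈ S' → cw 0 ≠ 0) ∧ (w ∉ S' → ∀ i j : Fin 3, i ≠ j → slotSign L α w i ≠ slotSign L α w j → Circle.exp (cw i) ≠ Circle.exp (cw j))},
      IsCompact K → ∀ C : Set ↥(archLocal L 3 (Matrix.diagonal α) w), IsCompact C →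
        ∃ 𝒦 : Set (↥(archLocal L 3 (Matrix.diagonal α) w) ⧸ Subgroup.centralizer ({gprimeBlock L α w S' c₁} : Set ↥(archLocal L 3 (Matrix.diagonal α) w))),
          IsCompact 𝒦 ∧ ∀ cw ∈ K, ∀ y : ↥(archLocal L 3 (Matrix.diagonal α) w), y * gprimeBlock L α w S' (fun _ => cw) * y⁻¹ ∈ C →
            (QuotientGroup.mk y : ↥(archLocal L 3 (Matrix.diagonal α) w) ⧸ Subgroup.centralizer ({gprimeBlock L α w S' c₁} : Set ↥(archLocal L 3 (Matrix.diagonal α) w))) ∈ 𝒦 := by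
  by_cases hw : w ∈ S'
  · -- split place of `S′`: the regular set `{x ≠ 0}`
    refine uniformlyProper_mono _ _ (fun cw hcw => hcw.1 hw)
      (uniformlyProper_gprimeBlock_split_of_ne_zero L α S' hα hw (hS' w hw) c₁ (((mem_regG_iff S' c₁).1 hc₁).2 w hw))
  have hw' : ¬ (w ∈ S' ∧ w ∈ splitChartPlaces L α) := fun h => hw h.1
  by_cases hdef : formSign L α w 0 = formSign L α w 1 ∧ formSign L α w 1 = formSign L α w 2
  · -- DEFINITE place: `U(σ_w diag α)(ℂ)` compact, every chart uniformly proper everywhere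
    have hsgn : ∀ i, SignType.sign (formRe L α w i) = SignType.sign (formRe L α w 0) := by
      intro i
      have h0 : formSign L α w 0 = formSign L α w 0 := rfl
      fin_cases i
      · rfl
      · exact hdef.1.symm
      · exact (hdef.1.trans hdef.2).symm
    have hposdef : ((Matrix.diagonal α).map w.1.embedding).PosDef ∨ (-((Matrix.diagonal α).map w.1.embedding)).PosDef := by
      rw [diagonal_map_embedding_eq_of_real (hreal w)]
      rcases lt_or_gt_of_ne (formRe_ne_zero hα (hreal w) 0) with h0 | h0
      · right
        rw [Matrix.diagonal_neg]
        refine Matrix.PosDef.diagonal fun i => ?_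
        have hi : formRe L α w i < 0 := by
          have := hsgn i
          rw [sign_neg h0, sign_eq_neg_one_iff] at this
          exact this
        have : (0 : ℝ) < -formRe L α w i := by linarith
        exact_mod_cast this
      · left
        refine Matrix.PosDef.diagonal fun i => ?_
        have hi : 0 < formRe L α w i := by
          have := hsgn i
          rw [sign_pos h0, sign_eq_one_iff] at this
          exact this
        exact_mod_cast hi
    exact uniformlyProper_archLocal_of_definite L 3 (Matrix.diagonal α) w hposdef _ _ _
  · -- INDEFINITE compact-chart place: the odd slot `2` is simple on the `w`-factor of `InRegG`
    have hne : ∀ i, formSign L α w i ≠ 0 := fun i => by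
      show SignType.sign (formRe L α w i) ≠ 0
      rw [Ne, sign_eq_zero_iff]
      exact formRe_ne_zero hα (hreal w) i
    obtain ⟨h01, h02⟩ := sign_apply_lineOf (hne 0) (hne 1) (hne 2) hdef
    -- the two even lines carry the same sign: the stabiliser of the odd line is compact (§2)
    have hsame : ∀ m m', m ≠ lineOf (formSign L α w) 2 → m' ≠ lineOf (formSign L α w) 2 → 0 < formRe L α w m * formRe L α w m' := by
      have heven : ∀ m, m ≠ lineOf (formSign L α w) 2 → SignType.sign (formRe L α w m) = SignType.sign (formRe L α w (lineOf (formSign L α w) 0)) := by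
        intro m hm
        obtain ⟨k, rfl⟩ := (lineOf (formSign L α w)).surjective m
        have hk : k ≠ 2 := fun h => hm (by rw [h])
        have : k = 0 ∨ k = 1 := by
          fin_cases k
          · exact Or.inl rfl
          · exact Or.inr rfl
          · exact (hk rfl).elim
        rcases this with rfl | rfl
        · rfl
        · exact h01
      intro m m' hm hm'
      have h1 := heven m hm
      have h2 := heven m' hm'
      rcases lt_or_gt_of_ne (formRe_ne_zero hα (hreal w) (lineOf (formSign L α w) 0)) with h0 | h0
      · rw [sign_neg h0, sign_eq_neg_one_iff] at h1 h2
        nlinarith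
      · rw [sign_pos h0, sign_eq_one_iff] at h1 h2
        exact mul_pos h1 h2
    have hcpt := isCompact_stabilizer_single_of_sameSign L α w hα (hreal w) (lineOf (formSign L α w) 2) hsame
    haveI : LocallyCompactSpace ↥(archLocal L 3 (Matrix.diagonal α) w) := locallyCompactSpace_archLocal L 3 (Matrix.diagonal α) w
    have h := Literature.MeasureTheory.Group.uniformlyProper_of_isCompact_subgroup _
      (Subgroup.centralizer ({gprimeBlock L α w S' c₁} : Set ↥(archLocal L 3 (Matrix.diagonal α) w))) hcpt _
      (uniformlyProper_gprimeBlock_cpt_of_ne L α S' hα (hreal w) hw' 2 _ le_rfl)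
    refine uniformlyProper_mono _ _ ?_ h
    intro cw hcw j hj
    -- `InRegG`'s `w`-clause gives `e^{i cw 2} ≠ e^{i cw j}` for `j ≠ 2` (the slots `j` and `2` have opposite signs)
    have hsl : slotSign L α w j ≠ slotSign L α w 2 := by
      rw [slotSign_apply, slotSign_apply, h02]
      have hj01 : j = 0 ∨ j = 1 := by
        fin_cases j
        · exact Or.inl rfl
        · exact Or.inr rfl
        · exact (hj rfl).elim
      have hs0 : formSign L α w (lineOf (formSign L α w) 0) ≠ 0 := hne _
      have key : ∀ t : SignType, t ≠ 0 → t ≠ -t := by decide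
      rcases hj01 with rfl | rfl
      · exact key _ hs0
      · rw [h01]
        exact key _ hs0
    exact (hcw.2 hw j 2 hj hsl).symm

/-- **(HYP) MODULO THE CHART TORUS `T_{S′}` ON THE OFF-REAL-WALL PART OF `InRegG`**: for an admissible label `S′` the atlas `c ↦ gprimeTorus α S′ c` is uniformly proper modulo
`T_{S′}` on the OPEN set `{c | (∀ w ∈ S′, x_w ≠ 0) ∧ c ∈ InRegG (slotSign α) S′}` — the compact walls (two same-sign slots colliding at an indefinite compact-chart place) and
every point of a definite place INCLUDED.  Places assembly (★ `uniformlyProper_arch_of_places`) modulo `Z(gprimeTorus c₁) = T_{S′}` at a regular `c₁` (★ `dense_regG`,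
★ `chartTorusG_eq_centralizer`, ★ `symm_archPiEquivCM_mem_centralizer_gprimeTorus_iff`). [cite: Rogawski1990, §4.12 Lemma 4.12.1 p. 66; §8.3 p. 122; §4.3 p. 43]
[cite: HarishChandra1970, Part I §3 Lemma 22] [cite: DeitmarEchterhoff2014, Lemma 9.3.3] -/
theorem uniformlyProper_gprimeTorus_chartTorusG_inRegG (hα : ∀ i, α i ≠ 0) (hreal : ∀ (w : {w : InfinitePlace L // IsComplex w}) (i : Fin 3), (w.1.embedding (α i)).im = 0)
    (hS' : ∀ w, w ∈ S' → w ∈ splitChartPlaces L α) :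
    ∀ K ⊆ {c : {w : InfinitePlace L // IsComplex w} → Fin 3 → ℝ | (∀ w, w ∈ S' → c w 0 ≠ 0) ∧ c ∈ InRegG (slotSign L α) S'}, IsCompact K →
      ∀ C' : Set ↥(arch (↥(maximalRealSubfield L)) L (IsCMField.complexConj L) 3 (Matrix.diagonal α)), IsCompact C' →
        ∃ 𝒦' : Set (↥(arch (↥(maximalRealSubfield L)) L (IsCMField.complexConj L) 3 (Matrix.diagonal α)) ⧸ chartTorusG L α S'),
          IsCompact 𝒦' ∧ ∀ c ∈ K, ∀ y' : ↥(arch (↥(maximalRealSubfield L)) L (IsCMField.complexConj L) 3 (Matrix.diagonal α)),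
            y' * gprimeTorus L α S' c * y'⁻¹ ∈ C' →
              (QuotientGroup.mk y' : ↥(arch (↥(maximalRealSubfield L)) L (IsCMField.complexConj L) 3 (Matrix.diagonal α)) ⧸ chartTorusG L α S') ∈ 𝒦' := by
  -- a regular reference point
  obtain ⟨c₁, hc₁⟩ := (dense_regG S').nonempty
  rw [chartTorusG_eq_centralizer L α S' hα hS' hc₁]
  intro K hK hKc C' hC'
  have hKS : K ⊆ Set.pi Set.univ fun w => (fun c : {w : InfinitePlace L // IsComplex w} → Fin 3 → ℝ => c w) '' K :=
    fun c hc w _ => ⟨c, hc, rfl⟩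
  have hprop : ∀ w : {w : InfinitePlace L // IsComplex w}, ∀ K₁ ⊆ (fun c : {w : InfinitePlace L // IsComplex w} → Fin 3 → ℝ => c w) '' K, IsCompact K₁ →
      ∀ C : Set ↥(archLocal L 3 (Matrix.diagonal α) w), IsCompact C →
        ∃ 𝒦 : Set (↥(archLocal L 3 (Matrix.diagonal α) w) ⧸ Subgroup.centralizer ({gprimeBlock L α w S' c₁} : Set ↥(archLocal L 3 (Matrix.diagonal α) w))),
          IsCompact 𝒦 ∧ ∀ cw ∈ K₁, ∀ y : ↥(archLocal L 3 (Matrix.diagonal α) w), y * gprimeBlock L α w S' (fun _ => cw) * y⁻¹ ∈ C →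
            (QuotientGroup.mk y : ↥(archLocal L 3 (Matrix.diagonal α) w) ⧸ Subgroup.centralizer ({gprimeBlock L α w S' c₁} : Set ↥(archLocal L 3 (Matrix.diagonal α) w))) ∈ 𝒦 := by
    intro w
    refine uniformlyProper_mono _ _ ?_ (uniformlyProper_gprimeBlock_of_inRegG_place L α S' hα hreal hS' hc₁ w)
    rintro _ ⟨c, hc, rfl⟩
    exact ⟨fun hw => (hK hc).1 w hw, fun hw i j hij hs => (hK hc).2 w hw i j hij hs⟩
  obtain ⟨𝒦', h𝒦', hmem⟩ := uniformlyProper_arch_of_places L 3 (Matrix.diagonal α)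
    (fun w => Subgroup.centralizer ({gprimeBlock L α w S' c₁} : Set ↥(archLocal L 3 (Matrix.diagonal α) w)))
    (Subgroup.centralizer ({gprimeTorus L α S' c₁} : Set _)) (symm_archPiEquivCM_mem_centralizer_gprimeTorus_iff L α S' c₁)
    (fun w cw => gprimeBlock L α w S' (fun _ => cw)) _ hprop K hKS hKc C' hC'
  exact ⟨𝒦', h𝒦', fun c hc y' hy' => hmem c hc y' (by rwa [gprimeTorus_eq_symm_blockChart] at hy')⟩

omit [IsCMField L] in
/-- The off-real-wall part of `InRegG` is OPEN. [cite: Bouaziz1994IntegralesOrbitales, §6.2 p. 591] -/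
theorem isOpen_setOf_forall_ne_inter_inRegG :
    IsOpen {c : {w : InfinitePlace L // IsComplex w} → Fin 3 → ℝ | (∀ w, w ∈ S' → c w 0 ≠ 0) ∧ c ∈ InRegG (slotSign L α) S'} := by
  have h1 : IsOpen {c : {w : InfinitePlace L // IsComplex w} → Fin 3 → ℝ | ∀ w, w ∈ S' → c w 0 ≠ 0} := by
    have he : {c : {w : InfinitePlace L // IsComplex w} → Fin 3 → ℝ | ∀ w, w ∈ S' → c w 0 ≠ 0} = ⋂ w ∈ S', {c | c w 0 ≠ 0} := by
      ext c; simp only [Set.mem_setOf_eq, Set.mem_iInter]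
    rw [he]
    exact isOpen_biInter_finset fun w _ => isOpen_ne_fun ((continuous_apply 0).comp (continuous_apply w)) continuous_const
  have h2 : IsOpen (InRegG (slotSign L α) S' : Set ({w : InfinitePlace L // IsComplex w} → Fin 3 → ℝ)) := by
    have he : InRegG (slotSign L α) S' = ⋂ w ∈ (Finset.univ \ S' : Finset {w : InfinitePlace L // IsComplex w}), ⋂ i : Fin 3, ⋂ j : Fin 3,
        {c : {w : InfinitePlace L // IsComplex w} → Fin 3 → ℝ | i ≠ j → slotSign L α w i ≠ slotSign L α w j → Circle.exp (c w i) ≠ Circle.exp (c w j)} := by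
      ext c
      simp only [InRegG, Set.mem_setOf_eq, Set.mem_iInter, Finset.mem_sdiff, Finset.mem_univ, true_and]
    rw [he]
    refine isOpen_biInter_finset fun w _ => isOpen_iInter_of_finite fun i => isOpen_iInter_of_finite fun j => ?_
    by_cases hij : i ≠ j ∧ slotSign L α w i ≠ slotSign L α w j
    · have he' : {c : {w : InfinitePlace L // IsComplex w} → Fin 3 → ℝ | i ≠ j → slotSign L α w i ≠ slotSign L α w j → Circle.exp (c w i) ≠ Circle.exp (c w j)} =
          {c | Circle.exp (c w i) ≠ Circle.exp (c w j)} := by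
        ext c; exact ⟨fun h => h hij.1 hij.2, fun h _ _ => h⟩
      rw [he']
      exact isOpen_ne_fun (Circle.exp.continuous.comp ((continuous_apply i).comp (continuous_apply w)))
        (Circle.exp.continuous.comp ((continuous_apply j).comp (continuous_apply w)))
    · have he' : {c : {w : InfinitePlace L // IsComplex w} → Fin 3 → ℝ | i ≠ j → slotSign L α w i ≠ slotSign L α w j → Circle.exp (c w i) ≠ Circle.exp (c w j)} = Set.univ := by
        ext c
        simp only [Set.mem_setOf_eq, Set.mem_univ, iff_true]
        intro h1 h2
        exact (hij ⟨h1, h2⟩).elim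
      rw [he']
      exact isOpen_univ
  exact h1.inter h2

end Places

end Literature.NumberTheory.Automorphic.UnitaryGroup

/-! ## §4 The heads: `chartOrbG`, `archRG`, `orbFamG` and the wall-extended `orbFamGExt` are `C^∞` on `InRegG` off the real walls -/

namespace Literature.NumberTheory.Automorphic.UnitaryGroup

section Heads

variable (L : Type) [Field L] [NumberField L] [IsCMField L] (α : Fin 3 → L)
  [MeasurableSpace ↥(arch (↥(maximalRealSubfield L)) L (IsCMField.complexConj L) 3 (Matrix.diagonal α))]
  [BorelSpace ↥(arch (↥(maximalRealSubfield L)) L (IsCMField.complexConj L) 3 (Matrix.diagonal α))]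
  (ν' : Measure ↥(arch (↥(maximalRealSubfield L)) L (IsCMField.complexConj L) 3 (Matrix.diagonal α))) [IsFiniteMeasureOnCompacts ν'] [ν'.IsMulRightInvariant]
  (S' : Finset {w : InfinitePlace L // IsComplex w})

/-- **«(I₂-cptwall-G′)»: `chartOrbG ν′ S′ a′` IS `C^∞` ON `InRegG` OFF THE REAL WALLS** — across every COMPACT wall and at every point of a definite place — for an admissible
label `S′` and every `a′ ∈ C_c^∞(G′_∞)` (§3 ∘ ★ `contDiffOn_chartOrbG_of_uniformlyProper`). [cite: Varadarajan1977, Part I §1.12] [cite: Rogawski1990, §8.3 pp. 122–124]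
[cite: Shelstad1979, §4 pp. 22–23] [cite: Bouaziz1994IntegralesOrbitales, §3.2 p. 580] -/
theorem contDiffOn_chartOrbG_inRegG (hα : ∀ i, α i ≠ 0) (hreal : ∀ (w : {w : InfinitePlace L // IsComplex w}) (i : Fin 3), (w.1.embedding (α i)).im = 0)
    (hS' : ∀ w, w ∈ S' → w ∈ splitChartPlaces L α)
    {a' : ↥(arch (↥(maximalRealSubfield L)) L (IsCMField.complexConj L) 3 (Matrix.diagonal α)) → ℂ} (ha' : ArchSmooth L 3 (Matrix.diagonal α) a') :
    ContDiffOn ℝ ∞ (chartOrbG L α ν' S' a') {c | (∀ w, w ∈ S' → c w 0 ≠ 0) ∧ c ∈ InRegG (slotSign L α) S'} :=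
  contDiffOn_chartOrbG_of_uniformlyProper L α ν' S' (isOpen_setOf_forall_ne_inter_inRegG L α S')
    (uniformlyProper_gprimeTorus_chartTorusG_inRegG L α S' hα hreal hS') ha'

/-- **`C⁰` twin**: `chartOrbG ν′ S′ a′` is CONTINUOUS on `InRegG` off the real walls for `a′ ∈ C_c(G′_∞)`. [cite: Rogawski1990, §8.3 pp. 122–124] [cite: Shelstad1979, §4 pp. 22–23] -/
theorem continuousOn_chartOrbG_inRegG (hα : ∀ i, α i ≠ 0) (hreal : ∀ (w : {w : InfinitePlace L // IsComplex w}) (i : Fin 3), (w.1.embedding (α i)).im = 0)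
    (hS' : ∀ w, w ∈ S' → w ∈ splitChartPlaces L α)
    {a' : ↥(arch (↥(maximalRealSubfield L)) L (IsCMField.complexConj L) 3 (Matrix.diagonal α)) → ℂ} (ha' : Continuous a') (ha'c : HasCompactSupport a') :
    ContinuousOn (chartOrbG L α ν' S' a') {c | (∀ w, w ∈ S' → c w 0 ≠ 0) ∧ c ∈ InRegG (slotSign L α) S'} :=
  continuousOn_chartOrbG_of_uniformlyProper L α ν' S' (isOpen_setOf_forall_ne_inter_inRegG L α S')
    (uniformlyProper_gprimeTorus_chartTorusG_inRegG L α S' hα hreal hS') ha' ha'c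

end Heads

end Literature.NumberTheory.Automorphic.UnitaryGroup

namespace Literature.NumberTheory.Automorphic.ArchCartan

section Coord

variable {W : Type*} [Fintype W] [DecidableEq W]

/-- **Shelstad's normaliser `archRG S′` is smooth OFF THE REAL WALLS** `{c | ∀ w ∈ S′, x_w ≠ 0}` (compact walls allowed: the compact-place factors `1 − e^{i(θ_j − θ_i)}` are
entire; only `|e^x − e^{−x}|` and the moduli `|e^{±x+iθ} − e^{iφ}|` at the split places need `x ≠ 0`). [cite: Shelstad1979, §4 p. 22] [cite: Rogawski1990, §8.2 p. 118] -/
theorem contDiffOn_archRG_of_forall_ne (S' : Finset W) : ContDiffOn ℝ ∞ (archRG S') {c : W → Fin 3 → ℝ | ∀ w, w ∈ S' → c w 0 ≠ 0} := by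
  unfold archRG
  refine contDiffOn_prod fun w _ => ?_
  by_cases hw : w ∈ S'
  · simp only [if_pos hw]
    intro c hc
    have hx : c w 0 ≠ 0 := hc w hw
    have hne : Real.exp (c w 0) - Real.exp (-c w 0) ≠ 0 := by
      intro h0
      have h' : c w 0 = -c w 0 := Real.exp_injective (sub_eq_zero.1 h0)
      exact hx (by linarith)
    have h0 : ContDiff ℝ ∞ fun c : W → Fin 3 → ℝ => c w 0 := contDiff_apply_apply ℝ ℝ w 0
    have h1 : ContDiff ℝ ∞ fun c : W → Fin 3 → ℝ => c w 1 := contDiff_apply_apply ℝ ℝ w 1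
    have h2 : ContDiff ℝ ∞ fun c : W → Fin 3 → ℝ => c w 2 := contDiff_apply_apply ℝ ℝ w 2
    have hg : ContDiff ℝ ∞ fun c : W → Fin 3 → ℝ => Real.exp (c w 0) - Real.exp (-c w 0) :=
      (Real.contDiff_exp.comp h0).sub (Real.contDiff_exp.comp h0.neg)
    have hz₁ : ContDiff ℝ ∞ fun c : W → Fin 3 → ℝ => Complex.exp ((c w 0 : ℂ) + (c w 2 : ℂ) * I) - Complex.exp ((c w 1 : ℂ) * I) :=
      (Complex.contDiff_exp.comp ((ofRealCLM.contDiff.comp h0).add ((ofRealCLM.contDiff.comp h2).mul contDiff_const))).sub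
        (Complex.contDiff_exp.comp ((ofRealCLM.contDiff.comp h1).mul contDiff_const))
    have hz₂ : ContDiff ℝ ∞ fun c : W → Fin 3 → ℝ => Complex.exp (-(c w 0 : ℂ) + (c w 2 : ℂ) * I) - Complex.exp ((c w 1 : ℂ) * I) :=
      (Complex.contDiff_exp.comp ((ofRealCLM.contDiff.comp h0).neg.add ((ofRealCLM.contDiff.comp h2).mul contDiff_const))).sub
        (Complex.contDiff_exp.comp ((ofRealCLM.contDiff.comp h1).mul contDiff_const))
    have hne₁ : Complex.exp ((c w 0 : ℂ) + (c w 2 : ℂ) * I) - Complex.exp ((c w 1 : ℂ) * I) ≠ 0 :=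
      cexp_add_mul_I_sub_cexp_mul_I_ne_zero hx _ _
    have hne₂ : Complex.exp (-(c w 0 : ℂ) + (c w 2 : ℂ) * I) - Complex.exp ((c w 1 : ℂ) * I) ≠ 0 := by
      have h := cexp_add_mul_I_sub_cexp_mul_I_ne_zero (neg_ne_zero.2 hx) (c w 2) (c w 1)
      simpa using h
    have hA : ContDiffAt ℝ ∞ (fun c : W → Fin 3 → ℝ => |Real.exp (c w 0) - Real.exp (-c w 0)|) c := hg.contDiffAt.abs hne
    have hB : ContDiffAt ℝ ∞ (fun c : W → Fin 3 → ℝ => ‖Complex.exp ((c w 0 : ℂ) + (c w 2 : ℂ) * I) - Complex.exp ((c w 1 : ℂ) * I)‖) c :=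
      hz₁.contDiffAt.norm ℝ hne₁
    have hC : ContDiffAt ℝ ∞ (fun c : W → Fin 3 → ℝ => ‖Complex.exp (-(c w 0 : ℂ) + (c w 2 : ℂ) * I) - Complex.exp ((c w 1 : ℂ) * I)‖) c :=
      hz₂.contDiffAt.norm ℝ hne₂
    exact (ofRealCLM.contDiff.contDiffAt.comp c ((hA.mul hB).mul hC)).contDiffWithinAt
  · simp only [if_neg hw]
    have he : ∀ i j : Fin 3, ContDiff ℝ ∞ fun c : W → Fin 3 → ℝ => (Circle.exp (c w j - c w i) : ℂ) := by
      intro i j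
      have h : (fun c : W → Fin 3 → ℝ => (Circle.exp (c w j - c w i) : ℂ)) = fun c => Complex.exp (((c w j - c w i : ℝ) : ℂ) * I) :=
        funext fun c => Circle.coe_exp _
      rw [h]
      exact Complex.contDiff_exp.comp
        ((ofRealCLM.contDiff.comp ((contDiff_apply_apply ℝ ℝ w j).sub (contDiff_apply_apply ℝ ℝ w i))).mul contDiff_const)
    exact (((contDiff_const.sub (he 0 1)).mul (contDiff_const.sub (he 0 2))).mul (contDiff_const.sub (he 1 2))).contDiffOn

end Coord

end Literature.NumberTheory.Automorphic.ArchCartan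

namespace Literature.NumberTheory.Rogawski1990

section Family

variable (L : Type) [Field L] [NumberField L] [IsCMField L] (α : Fin 3 → L)
  [MeasurableSpace ↥(arch (↥(maximalRealSubfield L)) L (IsCMField.complexConj L) 3 (Matrix.diagonal α))]
  [BorelSpace ↥(arch (↥(maximalRealSubfield L)) L (IsCMField.complexConj L) 3 (Matrix.diagonal α))]
  (ν' : Measure ↥(arch (↥(maximalRealSubfield L)) L (IsCMField.complexConj L) 3 (Matrix.diagonal α))) [IsFiniteMeasureOnCompacts ν'] [ν'.IsMulRightInvariant]
  (S' : Finset {w : InfinitePlace L // IsComplex w})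

/-- **The ordinary orbital family `orbFamG ν′ a′ S′` is `C^∞` on `InRegG` off the real walls** (admissible `S′`: `R′ · chartOrbG`; junk label: the zero family).
[cite: Shelstad1979, §4 pp. 22–23] [cite: Rogawski1990, §8.3 pp. 122–124] [cite: Bouaziz1994IntegralesOrbitales, §3.2 p. 580] -/
theorem contDiffOn_orbFamG_inRegG (hα : ∀ i, α i ≠ 0) (hreal : ∀ (w : {w : InfinitePlace L // IsComplex w}) (i : Fin 3), (w.1.embedding (α i)).im = 0)
    {a' : ↥(arch (↥(maximalRealSubfield L)) L (IsCMField.complexConj L) 3 (Matrix.diagonal α)) → ℂ} (ha' : ArchSmooth L 3 (Matrix.diagonal α) a') :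
    ContDiffOn ℝ ∞ (orbFamG L α ν' a' S') {c | (∀ w, w ∈ S' → c w 0 ≠ 0) ∧ c ∈ InRegG (slotSign L α) S'} := by
  by_cases hS' : ∀ w, w ∈ S' → w ∈ splitChartPlaces L α
  · have hEq : orbFamG L α ν' a' S' = fun c => archRG S' c * chartOrbG L α ν' S' a' c := funext fun c => orbFamG_apply L α ν' a' hS' c
    rw [hEq]
    exact ((contDiffOn_archRG_of_forall_ne S').mono fun c hc => hc.1).mul (contDiffOn_chartOrbG_inRegG L α ν' S' hα hreal hS' ha')
  · rw [orbFamG_of_not L α ν' a' hS']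
    exact contDiffOn_const

/-- **The ordinary orbital family of `a′ ∈ C_c(G′_∞)` is CONTINUOUS on `InRegG` off the real walls.** [cite: Shelstad1979, §4 pp. 22–23] [cite: Rogawski1990, §8.3 pp. 122–124] -/
theorem continuousOn_orbFamG_inRegG (hα : ∀ i, α i ≠ 0) (hreal : ∀ (w : {w : InfinitePlace L // IsComplex w}) (i : Fin 3), (w.1.embedding (α i)).im = 0)
    {a' : ↥(arch (↥(maximalRealSubfield L)) L (IsCMField.complexConj L) 3 (Matrix.diagonal α)) → ℂ} (ha' : Continuous a') (ha'c : HasCompactSupport a') :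
    ContinuousOn (orbFamG L α ν' a' S') {c | (∀ w, w ∈ S' → c w 0 ≠ 0) ∧ c ∈ InRegG (slotSign L α) S'} := by
  by_cases hS' : ∀ w, w ∈ S' → w ∈ splitChartPlaces L α
  · have hEq : orbFamG L α ν' a' S' = fun c => archRG S' c * chartOrbG L α ν' S' a' c := funext fun c => orbFamG_apply L α ν' a' hS' c
    rw [hEq]
    exact ((contDiffOn_archRG_of_forall_ne S').continuousOn.mono fun c hc => hc.1).mul (continuousOn_chartOrbG_inRegG L α ν' S' hα hreal hS' ha' ha'c)
  · rw [orbFamG_of_not L α ν' a' hS']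
    exact continuousOn_const

/-- **ON `InRegG` OFF THE REAL WALLS THE WALL-EXTENDED FAMILY IS THE RAW FAMILY**: `orbFamGExt ν′ a′ S′ c = orbFamG ν′ a′ S′ c` for `a′ ∈ C_c(G′_∞)` — at a `G`-regular `c` by
definition (★ `orbFamGExt_of_mem_regG`); at a compact-wall point the `RegG`-extension (★ `orbFamGExt_of_mem_inRegG_of_not_mem_regG`) returns the limit along `RegG`, which IS the value
by continuity of the raw family there (`continuousOn_orbFamG_inRegG` on an open set, ★ `mem_closure_regG`). [cite: Varadarajan1977, Part I §1.12] [cite: Shelstad1979, §4 pp. 22–24] -/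
theorem orbFamGExt_eqOn_orbFamG_inRegG (hα : ∀ i, α i ≠ 0) (hreal : ∀ (w : {w : InfinitePlace L // IsComplex w}) (i : Fin 3), (w.1.embedding (α i)).im = 0)
    {a' : ↥(arch (↥(maximalRealSubfield L)) L (IsCMField.complexConj L) 3 (Matrix.diagonal α)) → ℂ} (ha' : Continuous a') (ha'c : HasCompactSupport a') :
    EqOn (orbFamGExt L α ν' a' S') (orbFamG L α ν' a' S') {c | (∀ w, w ∈ S' → c w 0 ≠ 0) ∧ c ∈ InRegG (slotSign L α) S'} := by
  intro c hc
  by_cases hreg : c ∈ RegG S'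
  · exact orbFamGExt_of_mem_regG L α ν' a' S' hreg
  rw [orbFamGExt_of_mem_inRegG_of_not_mem_regG L α ν' a' S' hc.2 hreg]
  refine extendFrom_eq (mem_closure_regG S' c) ?_
  have hcont : ContinuousAt (orbFamG L α ν' a' S') c :=
    (continuousOn_orbFamG_inRegG L α ν' S' hα hreal ha' ha'c).continuousAt ((isOpen_setOf_forall_ne_inter_inRegG L α S').mem_nhds hc)
  exact hcont.tendsto.mono_left nhdsWithin_le_nhds

/-- **«(I₂-InRegG∖real walls-G′)» — THE WALL-EXTENDED GENUINE FAMILY `orbFamGExt ν′ a′ S′` IS `C^∞` ON `InRegG (slotSign α) S′` OFF THE REAL WALLS `x_w = 0`**, for every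
`a′ ∈ C_c^∞(G′_∞)` and every label `S′`: clause (I₂) `ContDiffOn ℝ ∞ (F S′) (InRegG s S′)` of ★ `ArchHcSmoothOneSided` for the genuine family of letter L1 (`HcOrbitalFamiliesStatement`),
HYPOTHESIS-FREE except on the real walls of the split places (where it is Harish-Chandra's `F_f^A` extension — ★ (A0) at order 0).  Across the COMPACT walls the proof is
elementary: the centraliser of a compact-wall point is compact modulo the chart torus (§2–§3), so the orbital integral is differentiated under the integral sign exactly as on the
regular set. [cite: Varadarajan1977, Part I §1.12] [cite: Rogawski1990, §8.3 pp. 122–124] [cite: Shelstad1979, §4 pp. 22–24] [cite: Bouaziz1994IntegralesOrbitales, §3.2 p. 580; §6.2 p. 591] -/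
theorem contDiffOn_orbFamGExt_inRegG_of_forall_ne (hα : ∀ i, α i ≠ 0) (hreal : ∀ (w : {w : InfinitePlace L // IsComplex w}) (i : Fin 3), (w.1.embedding (α i)).im = 0)
    {a' : ↥(arch (↥(maximalRealSubfield L)) L (IsCMField.complexConj L) 3 (Matrix.diagonal α)) → ℂ} (ha' : ArchSmooth L 3 (Matrix.diagonal α) a') :
    ContDiffOn ℝ ∞ (orbFamGExt L α ν' a' S') {c | (∀ w, w ∈ S' → c w 0 ≠ 0) ∧ c ∈ InRegG (slotSign L α) S'} :=
  (contDiffOn_orbFamG_inRegG L α ν' S' hα hreal ha').congr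
    (orbFamGExt_eqOn_orbFamG_inRegG L α ν' S' hα hreal ha'.continuous ha'.hasCompactSupport)

/-- **`C⁰` twin**: the wall-extended family of `a′ ∈ C_c(G′_∞)` is CONTINUOUS on `InRegG` off the real walls. [cite: Varadarajan1977, Part I §1.12] [cite: Shelstad1979, §4 pp. 22–24] -/
theorem continuousOn_orbFamGExt_inRegG_of_forall_ne (hα : ∀ i, α i ≠ 0) (hreal : ∀ (w : {w : InfinitePlace L // IsComplex w}) (i : Fin 3), (w.1.embedding (α i)).im = 0)
    {a' : ↥(arch (↥(maximalRealSubfield L)) L (IsCMField.complexConj L) 3 (Matrix.diagonal α)) → ℂ} (ha' : Continuous a') (ha'c : HasCompactSupport a') :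
    ContinuousOn (orbFamGExt L α ν' a' S') {c | (∀ w, w ∈ S' → c w 0 ≠ 0) ∧ c ∈ InRegG (slotSign L α) S'} :=
  (continuousOn_orbFamG_inRegG L α ν' S' hα hreal ha' ha'c).congr (orbFamGExt_eqOn_orbFamG_inRegG L α ν' S' hα hreal ha' ha'c)

end Family

end Literature.NumberTheory.Rogawski1990

end
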